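import Summits.BirchSwinnertonDyer.Rank1Residual.F1Sign2.SelfTwistAtTwo
import HarnessLib.Audit.Tags
import HarnessLib

/-!
# Cell `bsd-f1-sign2` — analytic lens (planner `-an` g21; MEMO-an v1.62 §24): AN-38 «THE THREE-BIT LAW FOR THE MODULAR DEGREE AT 2»
# — `ν(E) = [deg φ ≡ 2 (mod 4)] ⟺ (2) ρ̄_{E,2} ramified at 2 ∧ (∞) the egg locus ∧ (F₃) #Sel₂(E/F₃) = 4` on the AN-37 frame
# (file 1 of 2 of the §24 port: §24.1–§24.3 statement rows, statement-only; file 2 = `F1Sign2/ModularDegreeCubicFieldAtTwoKernel.lean` = kernel glue + S38c's proof)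

STATEMENTS ONLY (continues `F1Sign2/SelfTwistAtTwo.lean` = MEMO-an §23 whose frame (prime `N`, `Δ > 0`, no 2-torsion, sameK, `r_an = 1`, Fricke-plus,
`{∞,0}_f = 0`, `IsCubicTwoDivisionField`) is used BY NAME; ns `…F1Sign2.ANg21`): SIX conjecture-grade DATA LAWS as `@[conjecture] def … : Prop` —
**AN-38♮ `NuIffSupersingularOnEggLocusOfFiveModEight` (THE g21 CANDIDATE: at prime `N ≡ 5 (8)`, `ν = 1 ⟺` supersingular at 2 ∧ egg locus, 589/589)**,
AN-38♮⟸ `NuOneOfSupersingularOnEggLocusOfFiveModEight` (the new arrow), AN-38♮Ш `NuIffShaTwoTrivialOfSupersingularMeetsEggFiveModEight` (the modular degree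
detects `Ш[2]`), AN-38 `ThreeBitModularDegreeLawAtTwo` (all prime levels), AN-38♮′ `SelmerStableInCubicFieldOfSupersingularOnEggLocus`, AN-38♭⟸
`NuOneOfOnEggLocusSelmerStableOfThreeModFour`; THREE theorem-grade supports as plain `def … : Prop` — S38a `TwoDivisionFieldRamifiedOfSupersingular`, S38b
`TwoDivisionFieldRamifiedOfThreeModFour`, S38c `MinimalDiscriminantFiveModEightOfSupersingular` (PROVED in file 2).  Nothing asserted, no named fact, no
`sorry`; nothing here proves BSD or closes an item.

TYPER FILING (seat `bsd-f1-sign2-ty` g15; -an's PORT REQUEST D-an-112, INBOX 2026-08-29T05:18:24Z «`F1Sign2/ModularDegreeCubicFieldAtTwo.lean` = Sketch_v56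
statement layer verbatim (drop `0 < W.Δ` only if REF1 prefers; keep `Odd Dt.c`), glue into a Kernel file as for AN-37; S38c: land REF1's `s38c_holds`»;
CANDIDATES.md row AN-38): port of -an g21's `HOME/MEMO-an-data/g21/Sketch_v56.lean` sha16 **7f7cac80d556a840** (MEMO-an.md v1.62 §24; -an: farm rc 0, 0/0/0;
11 `@[conjecture]` + 7 defs/supports + 8 kernel glue; BC7 11/11 CLEAN `probe_v56_verdicts.txt`), re-checked by the typer against the tree.  THIS FILE =
the sketch's module docstring VERBATIM + its §24.1–§24.3 (the nine declarations above, bodies and docstrings VERBATIM, in the sketch's order and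
namespace, `0 < W.Δ` and `Odd Dt.c` KEPT), with one «REF1-AUDIT §174» / «REF2 v47 §10» sentence appended to each docstring and this header.  NOT IN THIS
FILING (REF-gated, to be APPENDED after REF1 g16's audit D-an-111a of «Sketch_v56 = v55 + 6 new Props»): the sketch's «§24.4 Classical faces» section
(`UnitsOfAllSignatures`, `NarrowClassNumberOdd`, `CalegariEmertonConditionFails`, `RayClassOddAtTwo`; AN-38♯ `TwoExactlyDividesModularDegreeIffRayClassOdd`
— -an's v1.62 RANK-FREE headline «2 ∥ m_E ⟺ #Cl_{𝔮⁴}(F₃) odd, 1911/1911» —, `NuIffNarrowClassNumberOddOfThreeModFour`, `NuIffCalegariEmertonFailsOfSupersingular`,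
`EggLocusIffCalegariEmertonFails`, `EggLocusOfNarrowClassNumberOdd` and their glue `nuOne_fiveModEight_of_classical`, `nuIff_rayClassOdd_onSlice`,
`eggLocus_of_nuOne_threeModFour`); REF2's placement of those faces is asked as D-an-111b.  AN-38♮Ш was added by -an after REF1 §174 (it audited Sketch_v55
7f971835b7f4c00b = this file's other eight declarations byte-for-byte, REF1 §174 A1) and is filed now because it is a KERNEL COROLLARY of the audited
AN-38♮ (`nuIffSha_of_nuIff`, file 2).
CENSUS = the BC5 witness MEMO-an v1.62 §24 (`HOME/MEMO-an-data/g21/`, SHA16SUMS; ENGINE CW j321811 + CW-x j323525/j323566/j324429 = eclib modular symbols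
+ toric periods, ENGINE H3/H3b/H3c/H4 = PARI certified class groups j325190/j325221/j325267/j325599, tag `bsd-frontier-data`; Cremona ecdata `N < 5·10⁵`
recounts `an38/`): three-bit law **304/304** two-engine rows `N ≤ 1.2·10⁵`, each clause load-bearing ((0,ram,κ=0,A₁≡2) 21 · (0,unram,κ=1,A₁≡2) 29 ·
(0,ram,κ=1,4∣A₁) 10 · ν = 1 ⟹ all three 148/148); AN-38♮ **589/589** both directions (330 ν = 1, 259 ν = 0; converse cell «ss ∧ egg locus ∧ ν = 0»
EMPTY); AN-38♮Ш 335/335; AN-38♮′ 116/116 (`N ≤ 1.2·10⁵`); Cremona ν = 1 ⟹ (2) ∧ (∞) 436/436; at-risk cell at `N ≡ 3 (4)` = 49 curves, `4 ∣ A₁` on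
10/10 computed (39 running: j324830/j324832 + insurance j325203/j325649/j325700 — fold as v1.62-add).  REF1's INDEPENDENT third engine (pure python on
Cremona, `REF1-data/b174/data/census174.{py,txt}`, `compare174.txt`): the 924 frame labels and EVERY E-only column (deg, ν, ss, κ, Ш_an, Tam) with
0 disagreements; faces (A) 589/589, (B) 104/104, (C) 106/106 + the at-risk 49 as a set.
REF1-AUDIT §174 (2026-08-29T04:50Z, `HOME/REF1-AUDIT-v1.md` l.3145; `REF1-data/b174/`) VERDICT verbatim: «The five data laws **SURVIVE as conjecture-grade data laws** (elaborate verbatim, non-vacuous, internally consistent, every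
clause load-bearing in data; REF1's third engine reproduces -an's E-only columns ROW FOR ROW, 924/924, and every face census exactly). S38a, S38b **SURVIVE
— THEOREM-GRADE (folklore; S38b by a three-line argument that needs no discriminant formula)**. **S38c is a THEOREM IN THE KERNEL:
`REF1g15w.s38c_holds : MinimalDiscriminantFiveModEightOfSupersingular`, SORRY-FREE, axioms {propext, Classical.choice, Quot.sound}** — candidate proof
handed to -ty (REF1 files nothing by charter). 0 killed, 0 not elaborating.»  Hypothesis audit: `0 < W.Δ` REDUNDANT given sameK (kept for the AN-37
frame; `ANg20.delta_pos_of_sameQuadraticResolventAtTwo` in `SelfTwistAtTwoKernel.lean`); `IsFrickeEigen` / `modularSymbol … 0 = 0` implied by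
`analyticRank = 1` (kept); `Odd Dt.c` LOAD-BEARING exactly in the arrows concluding `deg ≡ 2 (mod 4)`; `∀ F` the right quantifier.
REF2-PLACEMENT v47 §10 (e4ccb0b499d6c95a, 2026-08-29T04:43Z, PRE-placement ahead of the memo): AN-38 / 38♮ / 38♭ **NOT IN PRINT (conjecture-grade data
laws), not refuted in print; beyond-print theorem: no.**  What print has: (a) the FLOOR `2 ∣ deg φ` on the slice is a THEOREM — [cite: CalegariEmerton2009,
Thm. 1] (odd degree ⟹ ≤ 2 odd primes ∣ N, EVEN analytic rank, and rational 2-torsion or (prime N ∧ ss at 2 ∧ ℚ(E[2]) totally complex) or CM) and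
[cite: KazalickiKohen2017Watkins, Thm. 1] (odd modular degree ⟹ rank 0) — cite these for «ν well-defined»; (b) conjectures sharpened: [cite: Watkins2002,
Conj. 4.1, Conj. 4.2] (the printed «2 ∥ deg» precedent = Watkins' Neumann–Setzer remark, a 2-torsion family outside this frame), [cite: Dummigan2006, §1,
Conj. 5.3, Prop. 5.4] (Watkins «#Sel₂(E) ∣ deg φ … and something stronger involving the Atkin–Lehner subgroup»; mechanism Sel₂(E) → H¹(ℚ, Sym²E[2]) =
tangent space of R_φ at 2; Conj 5.3 (R_φ ≃ T_𝔪 c.i.) ⟹ 2^R ∣ deg Φ — OPEN IN PRINT); (c) Hecke-side shadow [cite: KedlayaMedvedovsky2018, Thm. 2, Conj. 13]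
(ordinary ⟺ ρ̄|_{G_{ℚ₂}} reducible; no ss curves at N ≡ 1, 7 (8); ss ⟹ K-dihedral at N ≡ 3, 5 (8) — the right cite for the bit-(2) dictionary);
(d) Yazdani 2011, Caro 2025 / Esparza-Lozano–Pasten (twists): other habitat; (e) `Odd Dt.c` is dischargeable in print for the OPTIMAL datum at prime
level (Česnavičius 2018, Manin conjecture for semistable E — not held, verify before tagging).  COSTUME CHECK of the (F₃)-bit: `H¹(F₃, E[2]) = H¹(ℚ, E[2])
⊕ H¹(ℚ, E[2]⊗E[2])` makes «`#Sel₂(E/F₃) = 4`» an avatar of Dummigan's Sym²E[2]-Selmer/tangent space being minimal — the load-bearing lever has PRIOR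
USE ON THIS PROBLEM (Dummigan 2006 §§3–5 divisibility; CE 2009 §3.2–3.3 the v₂ = 0 storey) ⟹ if carded: NEW-COMBINATION, real delta = (i) EXACTNESS
v₂ = 1 ⟺ three bits at R = 1, (ii) the ∞-bit as egg locus/Kummer class at ∞ with Ш[2] = 0, (iii) the N ≡ 5 (8) face with empty converse cell;
proof route in print = Dummigan Conj 5.3 (open; Allen 2014 Compositio 150 gives nearly-ordinary residually-dihedral R^{red} = T at 2, not the
numerical criterion).  -an's crux idea `ray-class-cubic-field-modular-degree-at-two` (commit 60b483f2bcf6) carries the §24.4 faces.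
PARTITION: none moved (v0.6 88/39/33/52/7/3); beyond-print theorem: no (data laws conjecture-grade; S38a/b folklore; S38c kernel-proved elementary
algebra); refuted in print: nothing; BSD not proved; no item closed.
bears_on: `stmt-BirchSwinnertonDyer-23715` `RankOneAtTwoBigImageOddLocal` — the residual class `{ν = 1}` at prime level: its `N ≡ 5 (8)` face is decided
E-only (ss ∧ egg locus), its `N ≡ 3 (4)` face by the (F₃)-bit.

## The sketch's own module docstring (verbatim)

# Cell `bsd-f1-sign2`, lens `-an` g21 (MEMO-an v1.62 §24): AN-38 «THE THREE-BIT LAW FOR THE MODULAR DEGREE AT 2»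
(sketch v56; statements + kernel glue only, no `sorry`).

Slice (as AN-37): `W/ℚ` globally minimal of PRIME conductor `N`, `Δ_W > 0`, `E(ℚ)[2] = 0`, sameK (`ℚ(√Δ) = ℚ(√N)`), analytic
rank `1`; parametrisation datum `Dt` with ODD Manin constant, Fricke-plus newform and `{∞,0}_f = 0`; `ν(E) := [deg φ ≡ 2 (mod 4)]`
(`deg φ` is even on the slice: CE 2009 Thm 1 — odd degree forces `E(ℝ)` connected and even analytic rank — and Kazalicki–Kohen 2018 Thm 1).  `F₃` = the cubic `2`-division field.  THREE BITS:
  (2)  `ρ̄_{E,2}` RAMIFIED at `2` (⟺ `2 ∣ d_{F₃}`; automatic at `N ≡ 3 (mod 4)`, ⟺ supersingular at `N ≡ 5 (mod 8)`, never at `N ≡ 1 (mod 8)`);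
  (∞)  the EGG LOCUS `OnEggLocusAtTwo W` (`E(ℚ)` meets the egg, `Ш(E)[2] = 0`, Tamagawa product odd — the last automatic here);
  (F₃) the `2`-Selmer group does NOT grow in `F₃` beyond the forced `E(F₃)[2] ≅ ℤ/2`: `#Sel₂(E/F₃) = 4`
       (⟺ `rank E(F₃) = 1 ∧ Ш(E/F₃)[2] = 0`; in the Waldspurger column ⟺ `A₁(E) ≡ 2 (mod 4)`, AN-37w/37t).
LAW (AN-38): `ν(E) = 1 ⟺ (2) ∧ (∞) ∧ (F₃)`.  DATA: ENGINE CW/CW-x (A₁) 304/304 prime levels `N ≤ 1.2·10⁵`, every clause load-bearing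
((0,ram,κ=0,A₁≡2) 21 · (0,unram,κ=1,A₁≡2) 29 · (0,ram,κ=1,4∣A₁) 10 · ν=1 ⟹ all three 148/148); Cremona `N < 5·10⁵`: ν=1 ⟹ (2)∧(∞) 436/436.
FACE AT `N ≡ 5 (mod 8)` (AN-38♮, `E`-only, engine-free): `ν = 1 ⟺ E supersingular at 2 ∧ OnEggLocusAtTwo` — **589/589** (all such curves
`N < 5·10⁵`; 330 with ν = 1, 259 with ν = 0; the converse cell «ss ∧ egg locus ∧ ν = 0» is EMPTY), whereas the same converse FAILS 49 times
out of 155 at `N ≡ 3 (mod 4)`, where the (F₃)-bit decides (10/10 + kit j324830/j324832 pending).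
READING (heuristic, `R = T_𝔪` at `p = 2` not available): `v₂(deg φ) − 1 = #`{extra first-order minimal deformations}; sources = the prime 2
(CE 2009 §3.3), the real place (`#Gal(ℂ/ℝ) = 2`: `H¹(ℝ, ad⁰ρ̄) ≠ 0` on the totally-real slice — the egg locus says the Kummer class of the
generator is visible at ∞), and the cubic field (Shapiro: `H¹(F₃, E[2]) = H¹(ℚ, E[2]) ⊕ H¹(ℚ, E[2] ⊗ E[2])`, `E[2] ⊗ E[2] = End E[2] ⊃ ad⁰`).
It is the `v₂ = 1`, `Δ > 0` storey of Calegari–Emerton's `v₂ = 0` theorem (odd degree ⟹ ss at 2 ∧ `E(ℝ)` connected; Prop. 25: class number /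
unit of the cubic field obstruct), with an exact converse.
CLASSICAL FACES (§24.4, ENGINE H3/H3b/H3c = kit j325190/j325221/j325267, PARI certified class groups of all 924 `F₃`): the three-bit law is
EQUIVALENT on the data to **«ν = 1 ⟺ F₃ ramified at 2 ∧ #Cl_{𝔡²}(F₃) odd»** (`𝔡 = 𝔮²` the 2-part of the different, `𝔮` the ramified prime) —
924/924: supersingular face (`2 = 𝔮³`, 479): `ν = 1 ⟺ #Cl_{𝔮²}(F₃)` odd ⟺ «`h(F₃)` odd and some unit has `u − 1 ∉ 𝔮²`» = the NEGATION of the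
Calegari–Emerton Prop 25 hypothesis (330/149); ordinary-ramified face (`2 = 𝔭𝔮²`, 231): `ν = 1 ⟺ h⁺(F₃)` odd ⟺ `#Cl_{(4)}(F₃)` odd (106/125 —
CE's genus-field deformation); unramified (214): `ν = 0`.  `E ↔ F₃` dictionary (S38d): on the ramified faces egg locus ⟺ `#Cl_{(2)}(F₃)` odd,
710/710.  Ray class groups are typed through their elementary unit/class-number equivalents (`NarrowClassNumberOdd`, `CalegariEmertonConditionFails`).
[cite: CalegariEmerton2009, Thm 1, §3.2–3.3, Prop 25 (arXiv math/0503359 numbering)] [cite: Watkins2002, Conj. 4.1] [cite: Dummigan2006, §1] [cite: KedlayaMedvedovsky2018, Conj. 13]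
[cite: MartinWhitehouse2008, Thm. 4.1] [cite: DokchitserDokchitser2010ModSquares, §2]
APPEND (-ty g15, 2026-08-29T07:2xZ; REF-gate RELEASED by REF1 §176, STATUS 05:48Z): the sketch's «§24.4 Classical faces» and «§24.8 composite floor»
(= MEMO-an v1.62 §24.4 + v1.62-add §24.8; `HOME/MEMO-an-data/g21/Sketch_v57.lean` sha16 **5aeae968dae563e6** = Sketch_v56 7f7cac80d556a840 + the pure
insertion l.342–409; -an: farm rc 0, BC7 13/13 CLEAN) are now appended BELOW the §24.1–§24.3 declarations, VERBATIM (section docstrings, decl bodies and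
docstrings byte-identical, `section ClassicalFaces` / `section CompositeFloor` with `open NumberField` as in the sketch), one «REF1-AUDIT §176» + one
«REF2 v47 §13/§17/§18» sentence appended to each docstring: typings `UnitsOfAllSignatures`, `NarrowClassNumberOdd`, `CalegariEmertonConditionFails`,
`RayClassOddAtTwo`, `omegaConductor` (plain `def`s) and the laws AN-38♯(3 mod 4) `NuIffNarrowClassNumberOddOfThreeModFour`, AN-38♮CE
`NuIffCalegariEmertonFailsOfSupersingular`, S38d `EggLocusIffCalegariEmertonFails`, S38e `EggLocusOfNarrowClassNumberOdd`, rank-free AN-38♯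
`TwoExactlyDividesModularDegreeIffRayClassOdd`, AN-38♯F1 `TwoAdicFloorOfModularDegree`, AN-38♯F `ModularDegreeOnFloorForcesRayClassOdd` (`@[conjecture]`);
the glue `nuOne_fiveModEight_of_classical`, `nuIff_rayClassOdd_onSlice`, `eggLocus_of_nuOne_threeModFour`, `omegaConductor_of_prime`, `rayClassOdd_of_nu_prime`
and REF1 §176's kernel certificates go to `ModularDegreeCubicFieldAtTwoKernel.lean`.  REF1-AUDIT §176 (`HOME/REF1-AUDIT-v1.md` aa559373bac03d6b l.3166,
`REF1-data/b176/`) VERDICT: «All 8 new laws SURVIVE as conjecture-grade data laws (♮Ш, AN-38♯(3 mod 4), ♮CE, S38d, S38e, rank-free AN-38♯, F1, F); the 4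
typings are FAITHFUL on every slice field (and come with two THEOREM-GRADE riders T176a/T176b that make the three face laws COROLLARIES of the rank-free
law); `omegaConductor` ✓; all 6 glue theorems replay in the kernel against VERBATIM copies. 0 killed, 0 not elaborating»; BC7: rank-free law 1911/1911,
faces 231/231 · 479/479 · 924/924, S38d 710/710, S38e 346/346, ♮Ш 335/335 (REF1 E-side engine × -an's certified PARI columns, 0 disagreements); §24.8 F1/F2
THIRD ENGINE to `N < 5·10⁵`: F1 0/129 772 violations, F2 0/11 033.  REF2-PLACEMENT v47 §13 (D-an-111b): AN-38♯ and both faces **NOT IN PRINT**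
(conjecture-grade data laws; CE 2009 Prop 25's hypothesis TRANSPLANTED to the totally real cubic and PROMOTED to an iff one storey up; open-problem
adjacency `R = 𝕋_𝔪` at `p = 2` for `S₃`-image `ρ̄`); S38d / S38e = **VARIANTS of printed theorems** ([cite: BrumerKramer1977, §7],
[cite: ChaoLi2018TwoSelmer, Thm. 1.1], [cite: BarrerasalazarPacettiTornaria2021, Thm. 1.7], [cite: YooYu2022, Thm. 1.6]) — theorem-grade, first prover targets,
cite and derive, do not claim; §17/§18 (D-an-111d): F1 IN PRINT on {all `w_p = +1`} ([cite: DummiganKrishnamoorthy2013, Prop. 2.1]), conjecture-grade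
beyond print on {∃ split `p`}; F NOT IN PRINT; [cite: SteinWatkins2004, Conj. 4.1] OPEN IN PRINT; sameK at prime level = [cite: MestreOesterle1989]
modulo wording.  REF2 §21 KEY TRAP fixed (-ty g15, 06:3xZ, text only): the two `[cite: AgasheRibetStein…, Thm 2.1]` tags (F1 docstring = the sketch's own tag, and
F's rider) now use `AgasheRibetStein2012` («The modular degree, congruence primes, and multiplicity one», Thm 2.1 «m_E ∣ r_E and if ord_p(N) ≤ 1 then
ord_p(r_E) = ord_p(m_E)») instead of `AgasheRibetStein2006` («The Manin Constant») — the one deliberate deviation from the sketch's docstring text.  REF2 §16 nit folded here: the `[cite: CalegariEmerton2009, … Prop 25]` tags of this file use the arXiv math/0503359 numbering (Israel J.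
Math. 169 numbering unverified).  CANDIDATES.md row AN-38 (pass 123).  PARTITION v0.6 unchanged; beyond-print theorem: no; BSD not proved.
-/

namespace Summit.BirchSwinnertonDyer.Rank1Residual.F1Sign2.ANg21

open Literature.NumberTheory.EllipticCurves Literature.NumberTheory.EllipticCurves.ModularForms UpperHalfPlane
open Literature.NumberTheory.EllipticCurves.Rank1Residual
open Summit.BirchSwinnertonDyer.Rank1Residual.F1Sign2 Summit.BirchSwinnertonDyer.Rank1Residual.F1Sign2.ANg17
open Summit.BirchSwinnertonDyer.Rank1Residual.F1Sign2.ANg18 Summit.BirchSwinnertonDyer.Rank1Residual.F1Sign2.ANg19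
open Summit.BirchSwinnertonDyer.Rank1Residual.F1Sign2.ANg20
open scoped Classical

noncomputable section

/-! ### §24.1 The face at `N ≡ 5 (mod 8)` — `E`-only vocabulary -/

/-- **AN-38♮ `NuIffSupersingularOnEggLocusOfFiveModEight` (DATA LAW, conjecture-grade; the lens's g21 candidate `Prop`).**  Prime level
`N ≡ 5 (mod 8)` (2 inert in `K = ℚ(√N)`), `Δ > 0`, `E(ℚ)[2] = 0`, sameK, analytic rank 1, datum with odd Manin constant, Fricke-plus, `{∞,0}_f = 0`:
`deg φ ≡ 2 (mod 4)` **iff** `E` has good SUPERSINGULAR reduction at 2 **and** lies on the EGG LOCUS (`E(ℚ) ⊄ E⁰(ℝ)`, `Ш(E)[2] = 0`, Tam odd).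
CENSUS (Cremona ecdata, all optimal prime-conductor rank-1 odd-torsion `Δ > 0` sameK curves `N < 5·10⁵` with `N ≡ 5 (mod 8)`: 589):
(ν, a₂ even, egg∧Ш_an=1) = (1,1,1) 330 · (0,0,0) 33 · (0,0,1) 77 · (0,1,0) 149 · **(0,1,1) 0** — 589/589, both directions.  ⟹ is AN-37d♮ (ss) +
AN-35e (egg locus); ⟸ is NEW (`NuOneOfSupersingularOnEggLocusOfFiveModEight`).  Why it might fail: a prime `N ≡ 5 (8)`, `E` ss at 2 on the egg
locus with `4 ∣ deg φ` (equivalently, by AN-38, with `Ш(E/F₃)[2] ≠ 0` or `rank E(F₃) = 3`), `N > 5·10⁵`. [conjecture — this memo, AN-38♮]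
[cite: CalegariEmerton2009, Thm 1 (3b), Prop 25 (arXiv numbering)] [cite: Watkins2002, Conj. 4.1]
REF1-AUDIT §174 (2026-08-29T04:50Z, `HOME/REF1-AUDIT-v1.md` l.3145; `REF1-data/b174/`): **SURVIVES as a conjecture-grade DATA LAW** — elaborates verbatim (goal read-back `Dt.modularDegree % 4 = 2 ↔ (GoodSS W 2 ∧ (MeetsEgg W ∧ ShaTwoTrivial W ∧ ¬ 2 ∣ W.tamagawaProduct))`), non-vacuous, every clause load-bearing; REF1 THIRD ENGINE (pure python on Cremona `N < 5·10⁵`) reproduces the 924 frame labels and every E-only column with 0 disagreements; face (A) `N ≡ 5 (8)`: 589 curves, cells (ν, ss, egg locus) = (0,0,0) 33 · (0,0,1) 77 · (0,1,0) 149 · (1,1,1) 330 · (0,1,1) 0 ⟹ both directions 589/589 (the `Ш`-clause of `OnEggLocusAtTwo` load-bearing on 5 rows, `MeetsEgg` on 144, `c_N` odd throughout); `0 < W.Δ` redundant given sameK (kept, AN-37 frame); `IsFrickeEigen`/`modularSymbol … = 0` implied by `analyticRank = 1` (kept); at `N ≡ 5 (8)` `GoodSS W 2 ⟺ 2 ∣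 d_{F₃}` (S38a / KM 2019 Thm 2).  REF2 v47 §10 (e4ccb0b499d6c95a, pre-placement): **NOT IN PRINT (conjecture-grade data law), not refuted in print; beyond-print theorem: no**; the FLOOR `2 ∣ deg φ` on the slice is a THEOREM [cite: CalegariEmerton2009, Thm. 1] [cite: KazalickiKohen2017Watkins, Thm. 1]; bit-(2) dictionary = [cite: KedlayaMedvedovsky2018, Thm. 2]; nearest conjectures [cite: Watkins2002, Conj. 4.1–4.2] [cite: Dummigan2006, Conj. 5.3, Prop. 5.4] (OPEN IN PRINT); if carded: NEW-COMBINATION (lever = tangent space of R at 2 ↔ 2-part of the congruence module: Dummigan 2006 §§3–5, CE 2009 §3.2–3.3). -/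
@[conjecture] def NuIffSupersingularOnEggLocusOfFiveModEight : Prop :=
  ∀ (W : WeierstrassCurve ℚ) [W.IsElliptic] [W.IsGloballyMinimal] [NeZero (W.conductorNorm ℤ)],
    Nat.Prime (W.conductorNorm ℤ) → W.conductorNorm ℤ % 8 = 5 → 0 < W.Δ → NoRationalTwoTorsion W → SameQuadraticResolventAtTwo W →
    W.analyticRank = 1 →
    ∀ (Dt : ModularParametrizationData W (W.conductorNorm ℤ)), Odd Dt.c →
      IsFrickeEigen (W.conductorNorm ℤ) Dt.f 1 → modularSymbol Dt.f 0 = 0 →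
      (Dt.modularDegree % 4 = 2 ↔ (GoodSS W 2 ∧ OnEggLocusAtTwo W))

/-- **AN-38♮⟸ `NuOneOfSupersingularOnEggLocusOfFiveModEight` (DATA LAW, conjecture-grade; the NEW arrow of AN-38♮).**  Same frame: good supersingular
reduction at 2 AND the egg locus FORCE `deg φ ≡ 2 (mod 4)` — at `N ≡ 5 (mod 8)` the two CE-type degeneracies (unramified at 2; Kummer class of the
generator invisible at ∞ / `Ш[2] ≠ 0`) are the ONLY sources of a second factor 2 in the congruence modulus.  330/330 (`N < 5·10⁵`), 0 exceptions;
the analogous arrow at `N ≡ 3 (mod 4)` is FALSE (49 counterexamples `N < 5·10⁵`, first `3391a1`, `5503a1`), which is what the cubic-field bit of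
AN-38 repairs.  `Odd Dt.c` is load-bearing (a datum with even Manin constant has `4 ∣ deg`). [conjecture — this memo, AN-38♮]
REF1-AUDIT §174 (2026-08-29T04:50Z, `HOME/REF1-AUDIT-v1.md` l.3145; `REF1-data/b174/`): **SURVIVES, conjecture-grade data law (the NEW arrow)**, 330/330 by REF1's third engine; `Odd Dt.c` LOAD-BEARING here; given AN-38 + S38a + `CubicTwoDivisionFieldExists` equivalent to AN-38♮′ (kernel `nuOne_fiveModEight_of_threeBit`, sibling glue file) — REF1 note (3): one row, the other glue.  REF2 v47 §10: NOT IN PRINT. -/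
@[conjecture] def NuOneOfSupersingularOnEggLocusOfFiveModEight : Prop :=
  ∀ (W : WeierstrassCurve ℚ) [W.IsElliptic] [W.IsGloballyMinimal] [NeZero (W.conductorNorm ℤ)],
    Nat.Prime (W.conductorNorm ℤ) → W.conductorNorm ℤ % 8 = 5 → 0 < W.Δ → NoRationalTwoTorsion W → SameQuadraticResolventAtTwo W →
    W.analyticRank = 1 →
    ∀ (Dt : ModularParametrizationData W (W.conductorNorm ℤ)), Odd Dt.c →
      IsFrickeEigen (W.conductorNorm ℤ) Dt.f 1 → modularSymbol Dt.f 0 = 0 →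
      GoodSS W 2 → OnEggLocusAtTwo W → Dt.modularDegree % 4 = 2

/-- **AN-38♮Ш `NuIffShaTwoTrivialOfSupersingularMeetsEggFiveModEight` (DATA LAW, conjecture-grade; THE MODULAR DEGREE DETECTS `Ш[2]`).**
Prime `N ≡ 5 (mod 8)`, slice as above, `E` supersingular at 2 and its GENERATOR OFF `E⁰(ℝ)` (`E(ℚ)` meets the egg), Tamagawa product odd
(automatic at prime sameK level): `deg φ ≡ 2 (mod 4)` **iff** `Ш(E)[2] = 0`.  CENSUS (Cremona `N < 5·10⁵`, all 335 such curves; `Ш` read as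
`Ш_an`): (ν, Ш_an) = (1, 1) 330 · (0, 4) 5 (`201389a1 228581b1 228581c1 281189a1 339517b1`) · (1, 4) 0 · (0, 1) 0 — 335/335.  A corollary of
AN-38♮ (kernel glue `nuIffSha_of_nuIff`); its ⟸ half reads `Ш[2]` off a modular-symbol computation, its ⟹ half is AN-35e.  Why it might fail: as
AN-38♮. [conjecture — this memo, AN-38♮Ш]
TYPER NOTE: added by -an AFTER REF1 §174's audit of Sketch_v55 7f971835b7f4c00b (REF1 g16 audit D-an-111a pending) — filed nevertheless because it is a KERNEL COROLLARY of the audited AN-38♮ (`nuIffSha_of_nuIff : NuIffSupersingularOnEggLocusOfFiveModEight → this`, sibling glue file, std axioms): it cannot be refuted as typed unless AN-38♮ is.  Census 335/335 (-an; REF1's third engine has the same 5 `(0, 4)` rows as the load-bearing `Ш`-clause).  REF2 v47 §10: NOT IN PRINT. -/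
@[conjecture] def NuIffShaTwoTrivialOfSupersingularMeetsEggFiveModEight : Prop :=
  ∀ (W : WeierstrassCurve ℚ) [W.IsElliptic] [W.IsGloballyMinimal] [NeZero (W.conductorNorm ℤ)],
    Nat.Prime (W.conductorNorm ℤ) → W.conductorNorm ℤ % 8 = 5 → 0 < W.Δ → NoRationalTwoTorsion W → SameQuadraticResolventAtTwo W →
    W.analyticRank = 1 → GoodSS W 2 → MeetsEgg W → ¬ 2 ∣ W.tamagawaProduct →
    ∀ (Dt : ModularParametrizationData W (W.conductorNorm ℤ)), Odd Dt.c →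
      IsFrickeEigen (W.conductorNorm ℤ) Dt.f 1 → modularSymbol Dt.f 0 = 0 →
      (Dt.modularDegree % 4 = 2 ↔ ShaTwoTrivial W)

/-! ### §24.2 The three-bit law (all prime levels) -/

/-- **AN-38 `ThreeBitModularDegreeLawAtTwo` (DATA LAW, conjecture-grade).**  Prime level, `Δ > 0`, `E(ℚ)[2] = 0`, sameK, analytic rank 1, datum as
above, `F` a cubic `2`-division field: `deg φ ≡ 2 (mod 4)` **iff** (2) `F` is ramified at 2 (⟺ `ρ̄_{E,2}|_{G_{ℚ₂}}` ramified) **and** (∞) the egg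
locus **and** (F₃) `#Sel₂(E/F) = 4` (no growth of the 2-Selmer group in the cubic 2-division field beyond the forced `E(F)[2] ≅ ℤ/2`; ⟺ `rank E(F) = 1
∧ Ш(E/F)[2] = 0`; the index `[E(F) : E(ℚ) + E(F)_tors]` is automatically odd since `[F:ℚ] = 3` is odd).  DICTIONARY to the Waldspurger column
(AN-37w + AN-37t bookkeeping, BSD-consistent): (F₃) ⟺ `A₁(E) ≡ 2 (mod 4)` (`A₁` = the `χ_E`-signed sum of toric periods on `Cl⁺(4N)`).
CENSUS (ENGINE CW j321811 + CW-x j323525/j323566/j324429; 304 prime-level curves, complete for `N ≤ 1.2·10⁵`; cells (ν, ram, κ, A₁ mod 4)):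
(0,F,0,0) 11 · (0,F,0,2) 9 · (0,F,1,0) 25 · (0,F,1,2) 29 · (0,T,0,0) 51 · (0,T,0,2) 21 · (0,T,1,0) 10 · (1,T,1,2) 148 — **0 violations, each clause
load-bearing**; faces: `N ≡ 1 (8)` ⟹ ν = 0 (AN-37d♮⁺, 104/104); `N ≡ 5 (8)`: AN-38♮ (589/589, the (F₃)-bit implied by the other two: AN-38♮′);
`N ≡ 3 (4)`: (2) automatic, ν = 1 ⟹ (∞) 106/106, converse cell (ν=0 ∧ (∞)) 49 curves `N < 5·10⁵`, `4 ∣ A₁` on 10/10 computed (kit j324830/j324832: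
the other 39).  Why it might fail: a prime-level ν = 0 curve on the egg locus, ramified at 2, with `#Sel₂(E/F₃) = 4`. [conjecture — this memo, AN-38]
[cite: CalegariEmerton2009, §3.2–3.3, Prop 25 (arXiv numbering)] [cite: MartinWhitehouse2008, Thm. 4.1] [cite: DokchitserDokchitser2010ModSquares, §2]
REF1-AUDIT §174 (2026-08-29T04:50Z, `HOME/REF1-AUDIT-v1.md` l.3145; `REF1-data/b174/`): **SURVIVES as a conjecture-grade DATA LAW** — goal read-back `… ↔ ((2:ℤ) ∣ NumberField.discr F ∧ OnEggLocusAtTwo W ∧ Nat.card ((W.baseChange F).selmerGroup 2) = 4)`; no junk carriers (`Nat.card Sel₂(E/F) = 4` asserts finiteness, intended); `∀ F` is the right quantifier (NoRationalTwoTorsion + sameK at prime `N` force the `S₃`-image, the three bits are conjugation-invariant); `ν` well defined on the frame (odd isogenies / `c²`-scalings preserve `deg ≡ 2 (4)` vs `4 ∣ deg`; `deg` even on 924/924, v₂ distribution 1:436 · 2:206 · 3:131 · 4:73 · 5:42 · 6:16 · 7:11 · 8:7 · 9:1 · 11:1); faces (B) `N ≡ 1 (8)` ν = 0 104/104, (C)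 `N ≡ 3 (4)` ν = 1 ⟹ egg locus 106/106, at-risk converse cell = 49 curves = -an's 10 computed + 39 pending AS SETS; the (F₃)/`A₁` bit (304 rows) cross-read only — cheapest falsifier remains one of the 39 pending at-risk curves with `A₁ ≡ 2 (mod 4)` (kit j324830/j324832).  REF2 v47 §10: NOT IN PRINT, not refuted; COSTUME CHECK of the (F₃)-bit: `H¹(F₃, E[2]) = H¹(ℚ, E[2]) ⊕ H¹(ℚ, E[2]⊗E[2])` makes «`#Sel₂(E/F₃) = 4`» an avatar of Dummigan's Sym²E[2]-Selmer / tangent space being minimal — lever with PRIOR USE (Dummigan 2006 §§3–5; CE 2009 §3.2–3.3) ⟹ NEW-COMBINATION; real delta = exactness `v₂ = 1 ⟺` three bits at `R = 1`, the ∞-bit as egg locus, the `N ≡ 5 (8)` face with empty converse cell; proof route in print = Dummigan Conj 5.3 (open; Allen 2014 gives nearly-ordinary residually-dihedral `R^{red} = T` at 2, not the numerical criterion). -/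
@[conjecture] def ThreeBitModularDegreeLawAtTwo : Prop :=
  ∀ (W : WeierstrassCurve ℚ) [W.IsElliptic] [W.IsGloballyMinimal] [NeZero (W.conductorNorm ℤ)],
    Nat.Prime (W.conductorNorm ℤ) → 0 < W.Δ → NoRationalTwoTorsion W → SameQuadraticResolventAtTwo W → W.analyticRank = 1 →
    ∀ (Dt : ModularParametrizationData W (W.conductorNorm ℤ)), Odd Dt.c →
      IsFrickeEigen (W.conductorNorm ℤ) Dt.f 1 → modularSymbol Dt.f 0 = 0 →
      ∀ (F : Type) [Field F] [NumberField F], IsCubicTwoDivisionField W F →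
        (Dt.modularDegree % 4 = 2 ↔
          ((2 : ℤ) ∣ NumberField.discr F ∧ OnEggLocusAtTwo W ∧ Nat.card ↥((W.baseChange F).selmerGroup 2) = 4))

/-- **AN-38♮′ `SelmerStableInCubicFieldOfSupersingularOnEggLocus` (DATA LAW, conjecture-grade; why the (F₃)-bit is silent at `N ≡ 5 (mod 8)`).**
Prime `N ≡ 5 (mod 8)`, slice as above: supersingular at 2 AND the egg locus ⟹ `#Sel₂(E/F₃) = 4`.  In the Waldspurger column: `A₁ ≡ 2 (mod 4)` on
116/116 such curves (`N ≤ 1.2·10⁵`); with AN-38 it is equivalent to AN-38♮⟸.  Local heuristic: at `N ≡ 5 (8)` ss, `ρ̄|_{G_{ℚ₂}}` has image all of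
`S₃` (`H⁰(ℚ₂, ad⁰ρ̄)` = scalars only), the smallest local condition at 2 of the five local types on the slice.  Why it might fail: one such curve with
`Ш(E/F₃)[2] ≠ 0`. [conjecture — this memo, AN-38♮′]
REF1-AUDIT §174 (2026-08-29T04:50Z, `HOME/REF1-AUDIT-v1.md` l.3145; `REF1-data/b174/`): **SURVIVES, conjecture-grade**; REF1 note (3): given AN-38 + S38a + `CubicTwoDivisionFieldExists` this row is EQUIVALENT to AN-38♮⟸ (one direction in kernel: `nuOne_fiveModEight_of_threeBit`) — count it as the glue partner of AN-38♮⟸, not a second obligation. -/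
@[conjecture] def SelmerStableInCubicFieldOfSupersingularOnEggLocus : Prop :=
  ∀ (W : WeierstrassCurve ℚ) [W.IsElliptic] [W.IsGloballyMinimal] [NeZero (W.conductorNorm ℤ)],
    Nat.Prime (W.conductorNorm ℤ) → W.conductorNorm ℤ % 8 = 5 → 0 < W.Δ → NoRationalTwoTorsion W → SameQuadraticResolventAtTwo W →
    W.analyticRank = 1 → GoodSS W 2 → OnEggLocusAtTwo W →
    ∀ (F : Type) [Field F] [NumberField F], IsCubicTwoDivisionField W F → Nat.card ↥((W.baseChange F).selmerGroup 2) = 4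

/-- **AN-38♭⟸ `NuOneOfOnEggLocusSelmerStableOfThreeModFour` (DATA LAW, conjecture-grade; the face of AN-38 under test by kit j324830/j324832).**
Prime `N ≡ 3 (mod 4)` (`K` ramified at 2, `E` ordinary, `ρ̄` ramified at 2 automatically): egg locus ∧ `#Sel₂(E/F₃) = 4` ⟹ `deg φ ≡ 2 (mod 4)`.
At-risk cell (ν = 0 ∧ egg locus) = 49 curves `N < 5·10⁵`; `4 ∣ A₁` (i.e. the Selmer bit fails, as the law demands) on the 10 computed so far
(`3391a1 5503a1 12227a1 15859a1 18523a1 31607a1 37811a1 39139a1 77543a1 104399a1`: A₁ = 0, 4, 32, 4, 0, 0, 16, −4, 4, 4).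
Why it might fail: one of the 39 pending curves with `A₁ ≡ 2 (mod 4)`. [conjecture — this memo, AN-38♭]
REF1-AUDIT §174 (2026-08-29T04:50Z, `HOME/REF1-AUDIT-v1.md` l.3145; `REF1-data/b174/`): **SURVIVES, conjecture-grade data law**; `Odd Dt.c` LOAD-BEARING; at-risk cell = 49 curves as a set (REF1 third engine), 10/10 computed `4 ∣ A₁` (-an v1.62: CW-x 10/10; the other 39 running, j324830/j324832 + insurance copies — verdicts fold as a v1.62-add line). -/
@[conjecture] def NuOneOfOnEggLocusSelmerStableOfThreeModFour : Prop :=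
  ∀ (W : WeierstrassCurve ℚ) [W.IsElliptic] [W.IsGloballyMinimal] [NeZero (W.conductorNorm ℤ)],
    Nat.Prime (W.conductorNorm ℤ) → W.conductorNorm ℤ % 4 = 3 → 0 < W.Δ → NoRationalTwoTorsion W → SameQuadraticResolventAtTwo W →
    W.analyticRank = 1 →
    ∀ (Dt : ModularParametrizationData W (W.conductorNorm ℤ)), Odd Dt.c →
      IsFrickeEigen (W.conductorNorm ℤ) Dt.f 1 → modularSymbol Dt.f 0 = 0 → OnEggLocusAtTwo W →
      ∀ (F : Type) [Field F] [NumberField F], IsCubicTwoDivisionField W F → Nat.card ↥((W.baseChange F).selmerGroup 2) = 4 →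
        Dt.modularDegree % 4 = 2

/-! ### §24.3 Supports (theorem-grade, local algebra) -/

/-- **S38a `TwoDivisionFieldRamifiedOfSupersingular` (THEOREM-CANDIDATE, local).**  `E(ℚ)[2] = 0`, good supersingular reduction at 2 ⟹ every cubic
`2`-division field is ramified at 2: inertia at 2 acts on `E[2]` through the level-2 fundamental character of order 3, so `2` has ramification index 3
in `ℚ(E[2])`, hence in `F₃` (`[ℚ(E[2]) : F₃] ≤ 2`). [folklore] [cite: Serre1972PointsOrdreFini, §1.11 & Prop. 12] [cite: CalegariEmerton2009, §3.1]
REF1-AUDIT §174 (2026-08-29T04:50Z, `HOME/REF1-AUDIT-v1.md` l.3145; `REF1-data/b174/`): **SURVIVES — THEOREM-GRADE (folklore)**: good supersingular at 2 ⟹ formal group of height 2 ⟹ tame inertia acts on `E[2]` through the level-2 fundamental characters (Serre 1972 §1.11) ⟹ `3 ∣ e(ℚ₂(E[2])/ℚ₂)` ⟹ `F₃` ramified at 2; `NoRationalTwoTorsion` not even needed for the implication; data (ram, ss) at `N ≡ 5 (8)` = (T,T) 479 · (F,F) 110 · mixed 0.  REF2 v47 §10: the bit-(2) dictionary is [cite: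 KedlayaMedvedovsky2018, Thm. 2] (ordinary ⟺ `ρ̄|_{G_{ℚ₂}}` reducible). -/
def TwoDivisionFieldRamifiedOfSupersingular : Prop :=
  ∀ (W : WeierstrassCurve ℚ) [W.IsElliptic] [W.IsGloballyMinimal], NoRationalTwoTorsion W → GoodSS W 2 →
    ∀ (F : Type) [Field F] [NumberField F], IsCubicTwoDivisionField W F → (2 : ℤ) ∣ NumberField.discr F

/-- **S38b `TwoDivisionFieldRamifiedOfThreeModFour` (THEOREM-CANDIDATE, algebra).**  Prime `N ≡ 3 (mod 4)`, `E(ℚ)[2] = 0`, sameK ⟹ every cubic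
`2`-division field is ramified at 2: `K = ℚ(√N)` has `d_K = 4N`, and for an `S₃`-cubic field with quadratic resolvent `K`, `d_{F₃} = d_K f²`.
[folklore] [cite: Cox2013, Thm 9.18 & (7.27)] [cite: CalegariEmerton2009, §3.1]
REF1-AUDIT §174 (2026-08-29T04:50Z, `HOME/REF1-AUDIT-v1.md` l.3145; `REF1-data/b174/`): **SURVIVES — THEOREM-GRADE by three lines, no Hasse formula needed**: sameK at prime `N ≡ 3 (4)` ⟹ `K = ℚ(√Δ_W) = ℚ(√N)` has `d_K = 4N`, so 2 ramifies in `K ⊂` Galois closure of `F` (the quadratic resolvent; `S₃`), and if 2 were unramified in `F` it would be unramified in each conjugate and in their compositum `⊇ K` — contradiction; data ram 231/231 at `N ≡ 3, 7 (8)`. -/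
def TwoDivisionFieldRamifiedOfThreeModFour : Prop :=
  ∀ (W : WeierstrassCurve ℚ) [W.IsElliptic] [NeZero (W.conductorNorm ℤ)],
    Nat.Prime (W.conductorNorm ℤ) → W.conductorNorm ℤ % 4 = 3 → NoRationalTwoTorsion W → SameQuadraticResolventAtTwo W →
    ∀ (F : Type) [Field F] [NumberField F], IsCubicTwoDivisionField W F → (2 : ℤ) ∣ NumberField.discr F

/-- **S38c `MinimalDiscriminantFiveModEightOfSupersingular` (THEOREM-CANDIDATE, three-line algebra; an elementary route to S37♭).**  For an INTEGRAL
Weierstrass model with `a₁` even and `Δ` odd, `Δ ≡ 5 (mod 8)`: with `a₁ = 2s`, `b₂ = 4(s² + a₂)`, `b₄ = 2(s a₃ + a₄)`, `b₆ = a₃² + 4a₆`, every term of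
`Δ = −b₂²b₈ − 8b₄³ − 27b₆² + 9b₂b₄b₆` but `−27b₆²` is `≡ 0 (mod 8)` — precisely `Δ = −27b₆² + 8Q` with
`Q := −2(s²+a₂)²b₈ − 8(a₄+sa₃)³ + 9(s²+a₂)(a₄+sa₃)b₆` (a `ring` identity; checked on 2·10⁴ random integer models) — and `Δ` odd forces `b₆` odd,
`b₆² ≡ 1 (mod 8)`, so `Δ ≡ −27 ≡ 5 (mod 8)`.
(Good reduction at 2 + supersingular ⟺ `a₁` even for a minimal model; with sameK, `Δ = N·m²`, `m` odd ⟹ `N ≡ 5 (mod 8)` = S37♭.) [folklore]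
REF1-AUDIT §174 (2026-08-29T04:50Z, `HOME/REF1-AUDIT-v1.md` l.3145; `REF1-data/b174/`): **A THEOREM IN THE KERNEL** — REF1's `REF1g15w.s38c_holds` (Probe174 l.115–125, sorry-free, std axioms; the `ring` identity is -an's `Q`, now certified) is LANDED in the sibling glue file as `ANg21.minimalDiscriminantFiveModEightOfSupersingular_holds : MinimalDiscriminantFiveModEightOfSupersingular` (typer g15, at REF1's request). -/
def MinimalDiscriminantFiveModEightOfSupersingular : Prop :=
  ∀ (a₁ a₂ a₃ a₄ a₆ : ℤ), Even a₁ → Odd (WeierstrassCurve.mk a₁ a₂ a₃ a₄ a₆).Δ → (WeierstrassCurve.mk a₁ a₂ a₃ a₄ a₆).Δ % 8 = 5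

/-! ### §24.4 Classical faces: class groups of the cubic field `F₃` (ENGINE H3/H3b/H3c = kit `j325190`/`j325221`/`j325267`, PARI
`bnfinit`+`bnfcertify` (GRH-free) / `bnrinit`, all 924 slice curves `N < 5·10⁵`).

THE CALEGARI–EMERTON PARALLEL, ONE STOREY UP.  CE09 (storey `v₂ = 0`, `E(ℝ)` connected, cubic field complex): `m_E` odd ⟹ `E` ss at 2, and
[CE09 Prop 25] «class number of the cubic field even, or its fundamental unit `ε` has `v_π(ε − 1) ≥ 2`» ⟹ a non-trivial minimal deformation
(⟹ `m_E` even, given `R = 𝕋` at 2); the ordinary-ramified case always deforms via a genus-field extension [CE09 §3.2].  HERE (storey `v₂ = 1`: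
`Δ > 0`, rank one, `m_E` even) the SAME dichotomies decide `4 ∣ m_E` EXACTLY, face by face (`𝔮` = the ramified prime of `F₃` above 2):
* `F₃` unramified at 2 (`E` ordinary, `N ≡ 1 (4)`; 214 curves): `ν = 0` (214/214);
* `E` ordinary, `F₃` ramified at 2 (`⟺ N ≡ 3 (4)`; `2 = 𝔭𝔮²`; 231 curves): `ν = 1 ⟺ h⁺(F₃)` odd (narrow class number; genus theory at `∞`)
  `⟺ #Cl_{(4)}(F₃)` odd `⟺ #Cl_{𝔮⁴}(F₃)` odd — 106 / 125, 0 exceptions (the 49 «at-risk» curves of §24.3 are exactly `h` odd, `h⁺ = 2h`);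
* `E` supersingular (`⟹ N ≡ 5 (8)`; `2 = 𝔮³`; 479 curves): `ν = 1 ⟺ #Cl_{𝔮²}(F₃)` odd `⟺ [h(F₃) odd ∧ ∃ unit u, v_𝔮(u − 1) = 1]` (the NEGATION
  of the CE09 Prop 25 hypothesis, for the totally real cubic) `⟺ #Cl_{𝔮⁴}(F₃)` odd — 330 / 149, 0 exceptions; and on this face
  `#Cl_{𝔮²}(F₃)` odd `⟺` egg locus (`P ∉ E⁰(ℝ) ∧ Ш[2] = 0`) — 479/479; on BOTH ramified faces egg locus `⟺ #Cl_{(2)}(F₃)` odd, 710/710 (S38d).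
UNIFORM FORM (all 924): `ν = 1 ⟺ F₃ ramified at 2 ∧ #Cl_{𝔡²}(F₃)` odd, `𝔡 = 𝔮²` the 2-part of the different of `F₃` (moduli `𝔮^a`, `a = 2…5`, decide
the ss face; only `𝔮⁴` (or `∞`, `(4)`, `𝔭^a𝔮⁴`, `𝔭³𝔮²`) decides the ordinary-ramified face; no modulus without `𝔮⁴`/`∞` catches the 49).
GLOBAL SHADOWS: `ν = 1 ⟹ h(F₃)` odd 436/436; `Ш_an = 4 ⟹ Cl(F₃)[2] ≠ 0` 15/15; `h⁺(F₃)` odd ⟹ egg locus 346/346; egg locus ⟹ `h(F₃)` odd 623/623.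
Ray class groups are not in Mathlib, so the two ramified faces are typed through their ELEMENTARY equivalents (narrow: `h` odd and units of every
signature; `𝔮²`: `h` odd and a unit `u` with `u − 1 ∉ 𝔮²`). -/

section ClassicalFaces
open NumberField

/-- Units of every signature: every totally positive unit of `F` is a square (`⟺ [𝓞ˣ : 𝓞ˣ₊] = 2^{r₁}`).
REF1-AUDIT §176 A2 (iii): FAITHFUL — ⟺ `E⁺ = E²` (totally positive units are squares) ⟺ (for totally real `F`) `[E : E⁺] = 2^{r₁}`; for a field
with a complex place it is FALSE rather than vacuous (`dim E/E² = r₁ + r₂ > r₁`) — off-slice rider only: on every law's frame `F` is the cubic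
`2`-division field of a curve with `Δ > 0`, hence totally real; kernel certificate `ANg21.isSquare_units_iff` (Kernel file): the square root may be
taken in `(𝓞 F)ˣ` or in `𝓞 F`. -/
def UnitsOfAllSignatures (F : Type) [Field F] [NumberField F] : Prop :=
  ∀ u : (𝓞 F)ˣ, (∀ σ : F →+* ℝ, 0 < σ ((u : 𝓞 F) : F)) → IsSquare u

/-- `h⁺(F)` odd, elementary form: `h(F)` odd and units of every signature.
REF1-AUDIT §176 A2 (iv): FAITHFUL — ⟺ `h⁺(F)` odd for totally real `F` (`h⁺ = h·2^{r₁}/[E : E⁺]`); -an's H3 rows `(h odd ∧ h⁺ = h) ⟺ h⁺ odd`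
924/924, `h⁺/h ∈ {1: 379, 2: 542, 4: 3}`. -/
def NarrowClassNumberOdd (F : Type) [Field F] [NumberField F] : Prop :=
  Odd (classNumber F) ∧ UnitsOfAllSignatures F

/-- `#Cl_{𝔮²}(F)` odd for the RAMIFIED degree-one prime `𝔮 ∣ 2` (`2 ∈ 𝔮²`), elementary form: `h(F)` odd and some unit `u` has `u − 1 ∉ 𝔮²`
(`u ≡ 1 (mod 𝔮)` is automatic) — the negation of the Calegari–Emerton Prop 25 hypothesis.  On the supersingular face `2 = 𝔮³` and on the
ordinary-ramified face `2 = 𝔭𝔮²` this is `#Cl_{(2)}(F₃)` odd (the unramified `𝔭` has `(𝓞/𝔭)ˣ = 1`).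
REF1-AUDIT §176 A2 (ii): ⟺ `h` odd ∧ ∃ `𝔮`, `e(𝔮|2) ≥ 2`, some unit `≢ 1 (mod 𝔮²)`; this equals «`#Cl_{𝔮²}(F)` odd» exactly when
`f(𝔮|2) = 1` — automatic on the cubic `2`-division field (`Σ eᵢfᵢ = 3`, `e ≥ 2`; PARI check (e,f) = (3,1)×479 ss, (2,1)+(1,1)×231 ord-ram); the
`∃ Q` clause CARRIES «`F` ramified at `2`» (certificate `ANg21.not_rayClassOddAtTwo_of_noRamifiedPrime`, Kernel file; `Q = ⊥` is excluded by
`2 ∉ ⊥²`).  REF2 v47 §13.1/§13.2 (b): [cite: CalegariEmerton2009, Prop. 25 (arXiv math/0503359 numbering)] verbatim is a GALOIS-SIDE existence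
statement («ρ̄ supersingular at 2 and TOTALLY COMPLEX; class number of K even, or the fundamental unit ε has v_π(ε − 1) ≥ 2 ⟹ a non-trivial
minimal deformation») for the COMPLEX cubic (unit rank 1), whose consequence «⟹ 2 ∣ m_E» needs `R = 𝕋` (CE §5); here its hypothesis is
TRANSPLANTED (totally real cubic, «∃ u», unit rank 2) — cite CE Prop 25 as «nearest print, hypothesis reused», never as support. -/
def CalegariEmertonConditionFails (F : Type) [Field F] [NumberField F] : Prop :=
  Odd (classNumber F) ∧ ∃ (u : (𝓞 F)ˣ) (Q : Ideal (𝓞 F)), Q.IsPrime ∧ (2 : 𝓞 F) ∈ Q ^ 2 ∧ ((u : 𝓞 F) - 1) ∉ Q ^ 2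

/-- **AN-38♯ `NuIffNarrowClassNumberOddOfThreeModFour` (DATA LAW, conjecture-grade; the ordinary-ramified face).**  Prime `N ≡ 3 (mod 4)` on the
slice (§24 frame): `deg φ ≡ 2 (mod 4)` **iff** the narrow class number of the cubic 2-division field `F₃` is odd.  CENSUS (ENGINE H3, certified):
(ν, h⁺ odd) = (1, ✓) 106 · (0, ✗) 125 · mixed 0 — 231/231, covering the whole at-risk cell of the three-bit law.  Why it might fail: a curve with
`h(F₃)` odd, units of every signature and an extra deformation at level `𝔮⁵` (none in range). [conjecture — this memo, AN-38♯; cf. CE09 §3.2]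
REF1-AUDIT §176: **SURVIVES as a conjecture-grade data law** (REF1 third engine 231/231, 0 column disagreements); **T176b (THEOREM-GRADE rider,
Kummer duality + Hilbert reciprocity for `(u, −1)`):** on a totally real cubic `F` with `2𝓞_F = 𝔭𝔮²` and `h(F)` odd, `rk₂ Cl_{𝔮⁴}(F) = rk₂ Cl_{(4)}(F)
= log₂(h⁺/h)`, so `#Cl_{𝔮⁴}` odd ⟺ `h⁺` odd, i.e. `RayClassOddAtTwo F ⟺ NarrowClassNumberOdd F` on this face — THIS LAW IS the rank-free law
`TwoExactlyDividesModularDegreeIffRayClassOdd` RESTRICTED to the `N ≡ 3 (4)` rank-1 slice (given S38b's splitting `2 = 𝔭𝔮²`): ONE obligation, not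
two (the forced agreement is the kernel glue `ANg21.narrow_iff_ray_onSlice_of_laws`, Kernel file); on this face `𝔮⁴`-surjectivity needs TWO
independent global units — exactly the room of the 49 at-risk curves of §174 (`h` odd, `h⁺ = 2h`, egg locus, ν = 0).  REF2 v47 §13.2 (c): **NOT IN
PRINT** (231/231); nearest print = [cite: CalegariEmerton2009, §3.2 (arXiv numbering)] genus-field mechanism at storey 0 (always an extra deformation);
the `h⁺(F₃)`-odd iff one storey up is new; beyond-print theorem: no. -/
@[conjecture] def NuIffNarrowClassNumberOddOfThreeModFour : Prop :=
  ∀ (W : WeierstrassCurve ℚ) [W.IsElliptic] [W.IsGloballyMinimal] [NeZero (W.conductorNorm ℤ)],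
    Nat.Prime (W.conductorNorm ℤ) → W.conductorNorm ℤ % 4 = 3 → 0 < W.Δ → NoRationalTwoTorsion W → SameQuadraticResolventAtTwo W →
    W.analyticRank = 1 →
    ∀ (Dt : ModularParametrizationData W (W.conductorNorm ℤ)), Odd Dt.c →
      IsFrickeEigen (W.conductorNorm ℤ) Dt.f 1 → modularSymbol Dt.f 0 = 0 →
      ∀ (F : Type) [Field F] [NumberField F], IsCubicTwoDivisionField W F →
        (Dt.modularDegree % 4 = 2 ↔ NarrowClassNumberOdd F)

/-- **AN-38♮CE `NuIffCalegariEmertonFailsOfSupersingular` (DATA LAW, conjecture-grade; the supersingular face = CE09 Prop 25 one storey up).**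
Prime `N` on the slice, `E` supersingular at 2 (then `N ≡ 5 (mod 8)` and `2 = 𝔮³` in `F₃`): `deg φ ≡ 2 (mod 4)` **iff** `h(F₃)` is odd and some unit
`u` of `F₃` has `v_𝔮(u − 1) = 1`.  CENSUS (ENGINE H3b, 479 ss curves): (ν, h odd, ∃u) = (1,✓,✓) 330 · (0,✓,✗) 81 · (0,✗,✓) 59 · (0,✗,✗) 9 · other 0.
Why it might fail: as AN-38♮ (it is equivalent to it given `EggLocusIffCalegariEmertonFails`). [conjecture — this memo; CE09 Prop 25]
REF1-AUDIT §176: **SURVIVES as a conjecture-grade data law** (479/479; CE table ss (ν, h odd, unit bit) = (0,0,0) 9 · (0,0,1) 59 · (0,1,0) 81 ·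
(1,1,1) 330); `GoodSS W 2` makes `N ≡ 5 (8)` automatic (S37♭/S38c), no `% 8 = 5` clause needed; **T176a (THEOREM-GRADE rider, local algebra at
`e(𝔮|2) = 3`, `f = 1`: `G₄ = (1+𝔮)/(1+𝔮⁴) ≅ ℤ/4 × ℤ/2`, `G₄/G₄² = 𝔽₂[1+π] ⊕ 𝔽₂[−1]`, and `G₄/G₄² → G₂` kills exactly `⟨[−1]⟩`):**
`𝓞ˣ·G₄² = G₄ ⟺ ∃ u ∈ 𝓞ˣ, u ≢ 1 (mod 𝔮²)`, i.e. `RayClassOddAtTwo F ⟺ CalegariEmertonConditionFails F` on such `F` (data: all 411 h-odd ss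
slice fields have `(P2, P4) ∈ {(0,0)×330, (1,1)×81}`) — so THIS LAW IS the rank-free law restricted to the supersingular rank-1 slice (given S38a:
ss ⟹ `2 = 𝔮³`): one obligation, not two (kernel glue `ANg21.ce_iff_ray_onSS_of_laws`; `⟸` unconditionally =
`ANg21.calegariEmertonConditionFails_of_rayClassOddAtTwo`).  REF2 v47 §13.2 (b): **NOT IN PRINT** — the condition is CE Prop 25's hypothesis
TRANSPLANTED (complex cubic/«the fundamental unit» → totally real cubic/«∃ u») and PROMOTED (sufficient-for-a-deformation at storey 0 → iff for
`4 ∣ m_E` at storey 1); open-problem adjacency: an `R = 𝕋_𝔪` / cotangent-length theorem at `p = 2` for `S₃`-image `ρ̄` (CE 2009 §5,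
[cite: Dummigan2006, §1]; Allen 2014 partial, nearly ordinary) — any proof of the «4 ∣ m_E» direction on this face is at least as hard as making
Prop 25's deformations modular of minimal level; beyond-print theorem: no. -/
@[conjecture] def NuIffCalegariEmertonFailsOfSupersingular : Prop :=
  ∀ (W : WeierstrassCurve ℚ) [W.IsElliptic] [W.IsGloballyMinimal] [NeZero (W.conductorNorm ℤ)],
    Nat.Prime (W.conductorNorm ℤ) → 0 < W.Δ → NoRationalTwoTorsion W → SameQuadraticResolventAtTwo W → W.analyticRank = 1 → GoodSS W 2 →
    ∀ (Dt : ModularParametrizationData W (W.conductorNorm ℤ)), Odd Dt.c →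
      IsFrickeEigen (W.conductorNorm ℤ) Dt.f 1 → modularSymbol Dt.f 0 = 0 →
      ∀ (F : Type) [Field F] [NumberField F], IsCubicTwoDivisionField W F →
        (Dt.modularDegree % 4 = 2 ↔ CalegariEmertonConditionFails F)

/-- **S38d `EggLocusIffCalegariEmertonFails` (ARITHMETIC DICTIONARY `E ↔ F₃`, conjecture-grade but of 2-descent type — no modular form in it).**
Prime `N`, `Δ > 0`, `E(ℚ)[2] = 0`, sameK, rank one, `F₃` RAMIFIED at 2 (both ramified faces, 710 curves): the generator is off `E⁰(ℝ)`,
`Ш(E)[2] = 0` and the Tamagawa number is odd **iff** `#Cl_{(2)}(F₃)` is odd, i.e. `h(F₃)` odd and some unit has `u − 1 ∉ 𝔮²`.  CENSUS (ENGINE H3c,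
`r₂ = rk₂ Cl_{(2)}(F₃)`): (egg, r₂) = (✓, 0) 485 · (✗, 1) 213 · (✗, 2) 12 (the twelve `Ш_an = 4` curves of these faces) · other 0 — **710/710**;
suggested identity `rk₂ Cl_{(2)}(F₃) = (dim Sel₂(E) − 1) + [P ∈ E⁰(ℝ)]` there (it fails on the unramified faces: (✗, 0) 40).  Why it might fail: it
is a Brumer–Kramer-type identity between `Sel₂(E/ℚ)` with its conditions at `2, ∞` and `Cl_{(2)}(F₃)[2]`; a proof should exist, a failure would be
a bookkeeping slip in the local condition at `𝔮`. [conjecture — this memo, S38d]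
REF1-AUDIT §176: **SURVIVES** (conjecture-grade as filed; third engine 710/710: (egg, rk₂Cl_{(2)}) = (1,0) 485 · (0,1) 213 · (0,2) 12; the
unramified face is rightly excluded — 40 egg-less curves there have `#Cl_{(2)}` odd); `(2 : ℤ) ∣ NumberField.discr F` is exactly «a prime with
`e ≥ 2` exists» on cubic `F`, matching the typing's built-in ramification.  REF2 v47 §13.3 (i): **a VARIANT of a printed theorem, theorem-grade,
PROVABLE FROM PRINT + one reflection step (first prover target):** on the slice (prime `N`, `E(ℚ)[2] = 0`, good at 2, `c_N` odd)
`dim Sel₂(E/ℚ) ∈ {rk₂ Cl_*(F₃,E)[2], rk₂ Cl_*(F₃,E)[2] + 1}`, fixed by the root number, is IN PRINT — [cite: BrumerKramer1977, §7] (Case 1),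
[cite: ChaoLi2018TwoSelmer, Thm. 1.1] (`Δ_F < 0`), [cite: BarrerasalazarPacettiTornaria2021, Thm. 1.7 and Hyp. 2.1, Def. 1.6] (`K = ℚ`: «the order of
the Selmer group is determined by the 2-torsion of Cl_*(A_ℚ,E) and the root number of E»), [cite: YooYu2022, Thm. 1.6, Def. 2.1, Rem. 2.2]
(semi-narrow class group; for `Δ > 0` the sign vectors at the three real places = BK's archimedean condition); S38d trades BPT's archimedean signs for
the modulus `(2)` + the `[P ∈ E⁰(ℝ)]` bit — the two descriptions are exchanged by the Kummer/reflection duality of Yoo–Yu Rem. 2.2 («note the switch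
between the indexes 0 and ∞»).  Duty: test the suggested identity `rk₂ Cl_{(2)}(F₃) = dim Sel₂(E) − 1 + [P ∈ E⁰(ℝ)]` against the printed
`dim Sel₂(E) = rk₂ Cl_*(F₃,E)[2] + δ_root` (add the `Cl_*` column to WIDE/FACES); a failure would contradict a printed theorem, i.e. an engine bug. -/
@[conjecture] def EggLocusIffCalegariEmertonFails : Prop :=
  ∀ (W : WeierstrassCurve ℚ) [W.IsElliptic] [W.IsGloballyMinimal] [NeZero (W.conductorNorm ℤ)],
    Nat.Prime (W.conductorNorm ℤ) → 0 < W.Δ → NoRationalTwoTorsion W → SameQuadraticResolventAtTwo W → W.analyticRank = 1 →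
    ∀ (F : Type) [Field F] [NumberField F], IsCubicTwoDivisionField W F → (2 : ℤ) ∣ NumberField.discr F →
      (OnEggLocusAtTwo W ↔ CalegariEmertonConditionFails F)

/-- **S38e `EggLocusOfNarrowClassNumberOdd` (ARITHMETIC SHADOW, conjecture-grade, 2-descent type).**  On the slice (any prime `N`): `h⁺(F₃)` odd ⟹
generator off `E⁰(ℝ)`, `Ш(E)[2] = 0`, Tamagawa odd.  CENSUS 346/346 (and `P ∈ E⁰(ℝ) ⟹ h⁺(F₃)` even 287/287, `Ш_an = 4 ⟹ h(F₃)` even 15/15).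
[conjecture — this memo, S38e]
REF1-AUDIT §176: **SURVIVES** (346/346: ss 166 / ord-ram 106 / unram 74).  REF2 v47 §13.3 (iii): PRINT-ASSEMBLY from the printed Selmer/class-group
bounds (`Cl ↞ Cl_* ↞ Cl⁺`) up to the `E⁰(ℝ)` clause — a VARIANT of [cite: BarrerasalazarPacettiTornaria2021, Thm. 1.7] / [cite: YooYu2022, Thm. 1.6]
(`h⁺` odd ⟹ `Cl_*` odd ⟹ `dim Sel₂(E) ≤ 1`); theorem-grade prover target, cite BK77 / Li 2018 / BPT 2021 / Yoo–Yu 2022, do not claim as new. -/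
@[conjecture] def EggLocusOfNarrowClassNumberOdd : Prop :=
  ∀ (W : WeierstrassCurve ℚ) [W.IsElliptic] [W.IsGloballyMinimal] [NeZero (W.conductorNorm ℤ)],
    Nat.Prime (W.conductorNorm ℤ) → 0 < W.Δ → NoRationalTwoTorsion W → SameQuadraticResolventAtTwo W → W.analyticRank = 1 →
    ∀ (F : Type) [Field F] [NumberField F], IsCubicTwoDivisionField W F → NarrowClassNumberOdd F → OnEggLocusAtTwo W

/-- `RayClassOddAtTwo F` — ELEMENTARY TYPING of «`F` is ramified at `2` and the ray class group `Cl_{𝔮⁴}(F)` has ODD order» for a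
prime `𝔮 ∣ 2` with `e(𝔮|2) ≥ 2` (`(2) ⊆ 𝔮²`; on the cubic `2`-division field: `𝔮³ = (2)` on the supersingular face, `𝔭𝔮² = (2)` on the
ordinary-ramified face, no such `𝔮` when `F` is unramified at `2`).  By the exact sequence `(𝓞/𝔮⁴)ˣ / im 𝓞ˣ ↪ Cl_{𝔮⁴}(F) ↠ Cl(F)`,
`#Cl_{𝔮⁴}` is odd iff `h(F)` is odd and the global units surject onto `(𝓞/𝔮⁴)ˣ ⊗ 𝔽₂`, i.e. every `a ∉ 𝔮` is `≡ u·b²  (mod 𝔮⁴)` for a unit `u`.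
(`𝔮⁴ = 𝔡²`, `𝔡` the `2`-primary part of the different, on both ramified faces.)  Mathlib has no ray class groups; this is the substitute.
REF1-AUDIT §176 A2 (i): **FAITHFUL for every number field** — with `G_k := (𝓞/𝔮^k)ˣ` and the exact sequence
`1 → G_k/im 𝓞ˣ → Cl_{𝔮^k} → Cl → 1`, `#Cl_{𝔮^k}` odd ⟺ `h` odd ∧ `im(𝓞ˣ)·G_k² = G_k` (abelian `G_k`, no 2-group hypothesis needed); the clause
`∀ a ∉ Q, ∃ u b, u b² − a ∈ Q⁴` is literally `im·G₄² = G₄` (`b ∉ Q` forced), so `RayClassOddAtTwo F ⟺ h(F)` odd ∧ ∃ prime `𝔮 ∣ 2`, `e(𝔮|2) ≥ 2`,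
`#Cl_{𝔮⁴}(F)` odd; `Q = ⊥` is prime in the domain `𝓞 F` but excluded (`2 ∉ ⊥²`, `CharZero`); the `∃ Q` is unique on cubic `F`; every typing is
isomorphism-invariant over the three conjugate cubics (§174 (iv)).  Kernel certificate (d) `ANg21.calegariEmertonConditionFails_of_rayClassOddAtTwo :
RayClassOddAtTwo F → CalegariEmertonConditionFails F` for EVERY number field (Kernel file; Dedekind `π ∈ Q ∖ Q²`, `a := 1 + π`) — the `𝔮⁴`-typing
formally refines the `𝔮²`-typing; on the two ramified faces the converse holds by T176a / T176b (REF1 §176, theorem-grade riders, not filed). -/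
def RayClassOddAtTwo (F : Type) [Field F] [NumberField F] : Prop :=
  Odd (classNumber F) ∧ ∃ Q : Ideal (𝓞 F), Q.IsPrime ∧ (2 : 𝓞 F) ∈ Q ^ 2 ∧
    ∀ a : 𝓞 F, a ∉ Q → ∃ (u : (𝓞 F)ˣ) (b : 𝓞 F), (u : 𝓞 F) * b ^ 2 - a ∈ Q ^ 4

/-- **AN-38♯ `TwoExactlyDividesModularDegreeIffRayClassOdd` — THE RANK-FREE UNIFORM CLASSICAL LAW (conjecture-grade data law).**
For EVERY optimal curve of PRIME conductor with `Δ > 0` and no rational `2`-torsion (any rank, no `L`-function, no generator, no sameK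
clause — at prime `N` with odd `v_N(Δ)` it is automatic): **`m_E ≡ 2 (mod 4) ⟺ #Cl_{𝔮⁴}(F₃)` odd for a prime `𝔮 ∣ 2` of `F₃ = ℚ(E[2])⁺` with
`e ≥ 2`** (`RayClassOddAtTwo`).  DATA (ENGINE H4 = kit j325599, PARI-certified, + Cremona `alldegphi`; `analyse_wide.py` → `WIDE.txt`):
**1911/1911** optimal prime-conductor curves with `Δ > 0`, odd torsion, `N < 5·10⁵`: (law, `2 ∥ m_E`) = (1,1) 685 · (0,0) 1226; by rank:
rank 0: 249 / 226 (faces: ss `ν = 1 ⟺ #Cl_{𝔮²}` odd ⟺ `Ш_an` odd 194/22; ordinary-ramified `ν = 1 ⟺ h⁺(F₃)` odd 55/66; unramified `4 ∣ m_E`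
138/138); rank 1: 436 / 488 (§24.4); rank 2: 0 / 441 and rank 3: 0 / 71 — the right-hand side NEVER holds at rank `≥ 2` (so, with Watkins'
`2^r ∣ m_E`, the law contains the Brumer–Kramer-type bound «`F₃` ramified at 2 ∧ `#Cl_{𝔮⁴}(F₃)` odd ⟹ rank `E(ℚ) ≤ 1`»).  CONTRAST (same job,
`Δ < 0`, complex cubic `F₃`, 3426 curves): storey 0 holds as «`m_E` odd ⟺ `E` supersingular at 2 ∧ `h(F₃)` odd» 1125/1125 at rank 0 (517 odd;
the unit clause of CE Prop 25 never bites; `h(F₃)` even ⟺ `Ш_an` even on that face, 67/67), the ordinary-ramified face obeys `ν = 1 ⟺ h(F₃)` odd at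
rank 1 (409/409), but on the supersingular and unramified faces at rank 1 NO modulus `2^a𝔮^b∞` decides `ν` ((ν, `h` odd) = 174/201/179/230 and
125/91/184/0): the cubic field alone decides the `2`-adic digit of `m_E` exactly on the TOTALLY REAL storey.
[cite: CalegariEmerton2009, Thm 1.1, Prop 25, §5] [cite: Watkins2002, Conj. 4.1–4.2] [cite: BrumerKramer1977, §§5–7]
REF1-AUDIT §176: **SURVIVES as a conjecture-grade data law** — REF1 third engine (E-side bits re-derived from Cremona ecdata × -an's certified PARI
columns, 0 meta disagreements): wide frame 1911 by rank {0: 475, 1: 924, 2: 441, 3: 71}, cells (R = [F₃ ramified ∧ rk₂Cl_{𝔮⁴} = 0], L = [2 ∥ deg φ]):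
rank 0 (0,0) 226 · (1,1) 249; rank 1 (0,0) 488 · (1,1) 436; rank 2 (0,0) 441; rank 3 (0,0) 71 — **LAW 1911/1911**, R never holds at rank ≥ 2; no
odd-degree curve (CE Thm 1); sameK 1911/1911 came for free (`Δ = N^{odd}` on every frame curve — REF2 v47 §18.2: IN PRINT modulo wording =
[cite: MestreOesterle1989, Thm. (|Δ| = N for strong Weil curves of prime conductor, N ∉ {11, 17, 19, 37})], exception list to be confirmed on the text
before relying on it; off optimal curves NOT automatic).  Hypothesis audit: `0 < W.Δ` LOAD-BEARING here (no sameK clause; at `Δ < 0` the statement is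
false — -an's H4 contrast block), `Odd Dt.c` load-bearing; mutation: dropping `Nat.Prime` kills `⟸` at composite level (-an's 4865 witnesses).
REF2 v47 §13.2 (a): **NOT IN PRINT; conjecture-grade data law; beyond-print theorem: no.**  Costume split for the «why novel» sentence: on
{`dim Sel₂(E) ≥ 2`} (rank ≥ 2 or `Ш[2] ≠ 0`) «4 ∣ m_E» is ALREADY the prediction of Watkins' printed conjecture «#Sel₂(E) ∣ m_E» ([cite: Dummigan2006,
§1]) composed with the printed `Sel₂ ↔ Cl_*(F₃)` theorem ([cite: BarrerasalazarPacettiTornaria2021, Thm. 1.7]) — so «R never at rank ≥ 2» and the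
`Ш_an = 4` cells are consistency, not novelty; the NEW content lives on {`dim Sel₂(E) ≤ 1`}: there «2 ∥ m_E ⟺ F₃ ramified at 2 ∧ #Cl_{𝔮⁴}(F₃) odd»
(e.g. the 81 ss rank-1 curves with `h(F₃)` odd, no unit with `v_𝔮(u − 1) = 1`, `Sel₂ = ℤ/2`, yet `4 ∣ m_E`) is predicted by NO printed theorem or
conjecture found — only antecedent CE Prop 25's unit clause one storey down; rank corollary «F₃ ramified at 2 ∧ #Cl_{𝔮⁴}(F₃) odd ⟹ rank ≤ 1» =
[cite: BarrerasalazarPacettiTornaria2021, Thm. 1.7] on the ordinary-ramified face, a `𝔮²`-ray VARIANT of it on the ss face («= BPT 2021 on one face»);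
NEW-COMBINATION if carded; [cite: DummiganKrishnamoorthy2013] (acq-02291 open) is load-bearing for the split — re-check on arrival. -/
@[conjecture] def TwoExactlyDividesModularDegreeIffRayClassOdd : Prop :=
  ∀ (W : WeierstrassCurve ℚ) [W.IsElliptic] [W.IsGloballyMinimal] [NeZero (W.conductorNorm ℤ)],
    Nat.Prime (W.conductorNorm ℤ) → 0 < W.Δ → NoRationalTwoTorsion W →
    ∀ (Dt : ModularParametrizationData W (W.conductorNorm ℤ)), Odd Dt.c →
    ∀ (F : Type) [Field F] [NumberField F], IsCubicTwoDivisionField W F →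
      (Dt.modularDegree % 4 = 2 ↔ RayClassOddAtTwo F)

end ClassicalFaces

section CompositeFloor
open NumberField

/-! ### §24.8 The `2`-adic FLOOR of the modular degree at odd squarefree level and what sitting on it forces (ENGINE H5, v1.62-add)

Data (ENGINE H5, kit j325821, PARI certified, 31662 cubic fields = every optimal curve of odd squarefree COMPOSITE conductor
`N < 10⁵` with odd torsion; ENGINE H5e, kit j325946, the 58703 with `2 ∥ N` squarefree; joined with ENGINE H4's 5337 prime-conductor fields): write `ω = ω(N)` and `m_E = deg φ`.
(F1) `Δ > 0 ⟹ 2^{ω(N)} ∣ m_E` — 9337/9337 odd composite + 16169/16169 at `2 ∥ N` + 1911/1911 prime (prime case IN PRINT: Calegari–Emerton 2009 Thm 1).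
(F2) `Δ > 0 ∧ 2^{ω(N)} ∥ m_E ⟹ ℚ(√Δ) = ℚ(√N)` (every bad prime has odd discriminant valuation) — 1045/1045 odd composite (5246 non-sameK
     curves: all have `2^{ω+1} ∣ m_E`) + 1937/1937 at `2 ∥ N` (10864 non-sameK above the floor) + prime level 685/685.
(F3) `Δ > 0 ∧ 2^{ω(N)} ∥ m_E ⟹ F₃` ramified at `2` and `#Cl_{𝔮⁴}(F₃)` odd — 1045/1045 odd composite ((law, floor) cells: ordinary-ramified
     (0,0) 1064 · (1,0) 840 · (1,1) 276; supersingular (0,0) 1171 · (1,0) 4025 · (1,1) 769; unramified (0,0) 1192, floor never attained)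
     + 1937/1937 at `2 ∥ N` (multiplicative at 2: faces (0,0) 3489 · (1,0) 8496 · (1,1) 1937, unramified (0,0) 2247) + prime level 685/685 (where the converse ALSO holds: AN-38♯).  At composite level the converse FAILS (4865 curves with the
     ray-class condition and `2^{ω+1} ∣ m_E`): the excess `v₂(m_E) − ω(N)` counts congruences from the other bad primes.
Heuristic (R = T at the maximal ideal of residue characteristic 2 attached to `ρ̄_{E,2}`, image `S₃`): `v₂(m_E) = v₂`(congruence number)
(Agashe–Ribet–Stein, `4 ∤ N`); the floor is attained iff there is no non-trivial mod-2 congruence, which forces `ρ̄` ramified at every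
`p ∣ N` (else Ribet level-lowering produces one: `v_p(Δ)` even ⟺ `ρ̄` unramified at `p` for a Tate curve) = (F2), ramified at 2 = first
half of (F3), and `H¹_f(ℚ, ad ρ̄) = 0`, whose class-field-theoretic shadow is `Cl_{𝔮⁴}(F₃)[2] = 0` = second half of (F3). -/

/-- `ω(N)`: the number of distinct prime factors of the conductor.
REF1-AUDIT §176: ✓ (`= 1` at prime level — `ANg21.omegaConductor_of_prime`, Kernel file —, `= 0` only at the mathematically empty conductor 1). -/
def omegaConductor (W : WeierstrassCurve ℚ) : ℕ := (W.conductorNorm ℤ).primeFactors.card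

/-- **AN-38♯F1 `TwoAdicFloorOfModularDegree` (conjecture-grade data law; prime case in print = CE 2009 Thm 1(b)).**  `W` globally minimal,
conductor `N` squarefree (either parity), `Δ_W > 0`, `E(ℚ)[2] = 0`, `Dt` a `Γ₀(N)`-parametrisation with odd Manin constant: `2^{ω(N)} ∣ deg φ`.
Census: 9337/9337 (odd composite, ENGINE H5) + 16169/16169 (`2 ∥ N`, ENGINE H5e) + 1911/1911 (prime, ENGINE H4) = 27417/27417.  Why it might fail: a curve with `Δ > 0` whose optimal
parametrisation has `v₂(deg φ) < ω(N)` beyond `N = 10⁵`; the Manin hypothesis is dischargeable for the optimal curve (Česnavičius 2018).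
[cite: CalegariEmerton2009, Thm 1] [cite: AgasheRibetStein2012, Thm 2.1 (deg φ ∣ congruence number, equal 2-parts when 4 ∤ N)]
REF1-AUDIT §176 (§24.8): **SURVIVES conjecture-grade; REF1 THIRD ENGINE, EXTENDED RANGE** (pure python over Cremona `alldegphi` + `allcurves`, ALL squarefree
`N < 5·10⁵`, optimal = curve 1 of its class, odd torsion; frames reproduce -an's to the unit): **0 violations on 129 772 `Δ > 0` curves** (25 506
composite + 574 prime with `N < 10⁵`; 102 355 composite + 1 337 prime with `10⁵ ≤ N < 5·10⁵` NEW beyond ENGINE H5/H5e).  Against the PRINTED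
Atkin–Lehner floor `ν₂(deg φ) ≥ ω(N) − [∃ split p ∣ N]` (holds on all 431 171 frame curves of either sign): THIS LAW is BEYOND PRINT exactly on
{`Δ > 0`, ∃ split p} = 116 625 curves, 0 violations, and IS PRINT on {all p non-split}; the printed floor is attained at `Δ < 0` (`ν₂ = ω − 1` on
10 223 curves), and {`Δ > 0`, all non-split} sits exactly ON `ω` 1 695 times — so the law reads «`Δ > 0 ⟹ ν₂ ≥ ω`», i.e.
`ν₂(m_E) ≥ max(AL-floor, ω(N)·𝟙[Δ > 0])`: «`Δ > 0` restores the one Atkin–Lehner bit lost to a split prime» (REF2 v47 §18.1; REF2's tentative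
re-base «AL-floor + 𝟙[Δ > 0]» was REFUTED by these data and WITHDRAWN).  Mutation: dropping `NoRationalTwoTorsion` kills the law in print's own terms
(DK's `− dim E(ℚ)[2]`); dropping `0 < W.Δ` kills it 10 223 times.  REF2 v47 §17 (2) / §18.1: **IN PRINT on {all w_p = +1}** = Dummigan–Krishnamoorthy
[cite: DummiganKrishnamoorthy2013, Prop. 2.1] (as recorded in the BKP 2023 survey arXiv:2308.13708 §2.5: E semistable, `W′ = ker(W → ±1, W_d ↦ w_d)`, a
homomorphism `W′ → E(ℚ)[2]` whose kernel has order dividing `m_E` ⟹ `ν₂(m_E) ≥ ω(N) − dim(W/W′) − dim E(ℚ)[2]`; parity case = CE 2009 Thm 2.1 (arXiv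
numbering) = [cite: Yazdani2011, Thm. 2.1 and Rem. 2.7]; mechanism named in [cite: Watkins2002, §4]); prime level = [cite: CalegariEmerton2009, Thm. 1 (b)
(arXiv numbering)]; **conjecture-grade BEYOND PRINT on {∃ split p}**; printed precedent of a «2 ∥ m_E» congruence law: [cite: SteinWatkins2004, Conj. 4.1]
(Neumann–Setzer family, OPEN IN PRINT; their theorem is the parity); DK 2013 §9 unread (acq-02291).  beyond-print theorem: no. -/
@[conjecture] def TwoAdicFloorOfModularDegree : Prop :=
  ∀ (W : WeierstrassCurve ℚ) [W.IsElliptic] [W.IsGloballyMinimal] [NeZero (W.conductorNorm ℤ)],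
    Squarefree (W.conductorNorm ℤ) → 0 < W.Δ → NoRationalTwoTorsion W →
    ∀ (Dt : ModularParametrizationData W (W.conductorNorm ℤ)), Odd Dt.c →
      2 ^ omegaConductor W ∣ Dt.modularDegree

/-- **AN-38♯F `ModularDegreeOnFloorForcesRayClassOdd` (conjecture-grade data law, NEW; the composite-level extension of the ⟹ half of
AN-38♯).**  Same frame; if `deg φ` sits on its `2`-adic floor (`2^{ω(N)+1} ∤ deg φ`) then (F2) `ℚ(√Δ_W) = ℚ(√N)` and (F3) the cubic
`2`-division field `F₃` is ramified at `2` with `#Cl_{𝔮⁴}(F₃)` odd (`RayClassOddAtTwo`).  Census: 1045/1045 odd composite (ENGINE H5) +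
1937/1937 at `2 ∥ N` (ENGINE H5e) + 685/685 prime (ENGINE H4); 0 exceptions among 27417 curves with `Δ > 0` (3667 on the floor).  Why it might fail: a floor curve with `#Cl_{𝔮⁴}(F₃)` even at
larger `N` or `ω(N) ≥ 5` (only 104 curves with `ω = 5` in range); the converse is FALSE at composite level (4865 witnesses, e.g. excess from
Atkin–Lehner congruences), so only this direction is filed.  [cite: CalegariEmerton2009, Prop 25 + §5] [cite: BrumerKramer1977, §7]
REF1-AUDIT §176 (§24.8): **SURVIVES conjecture-grade**; (F2) REF1 third engine: 0 violations on all 11 033 floor curves `N < 5·10⁵` (1045 + 1937 in -an's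
composite ranges; 2557 odd composite + 4809 with `2 ∥ N` NEW; prime 211 + 474 = 685 = -an's H4), while 87 324 non-sameK `Δ > 0` curves all sit
strictly above the floor; (F3) needs class groups — -an's 1045/1045 + 1937/1937 + 685/685 is the only engine (REF1 kit-free).  Typing notes: the floor
hypothesis `¬ 2^(ω+1) ∣ deg` also covers curves BELOW the floor (vacuous given F1, extra exposure without it — fine as filed; add
`2 ^ omegaConductor W ∣ Dt.modularDegree →` if independence from F1 is wanted); the law concludes sameK, so at prime level `ANg21.rayClassOdd_of_nu_prime`
(Kernel file) gives the ⟹ half of the rank-free law WITH sameK as output; `Squarefree` of either parity intended (ENGINE H5e); 177 of the 1045 floor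
curves have no split prime (REF2 §18.1: the §17.3 vacuity worry is WITHDRAWN).  REF2 v47 §17 (3): **(F2 ∧ F3) NOT IN PRINT, conjecture-grade**, the
composite-level analogue of AN-38♯ (§13); «`ℚ(√Δ) = ℚ(√N)`» ⟺ `ord_p Δ` odd ∀ `p ∣ N` ⟺ `ρ̄_{E,2}` ramified at every `p ∣ N` (Tate curve); the
«no mod-2 congruence» reading matches [cite: AgasheRibetStein2012, Thm. 2.1] («m_E ∣ r_E and if ord_p(N) ≤ 1 then ord_p(r_E) = ord_p(m_E)»);
beyond-print theorem: no. -/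
@[conjecture] def ModularDegreeOnFloorForcesRayClassOdd : Prop :=
  ∀ (W : WeierstrassCurve ℚ) [W.IsElliptic] [W.IsGloballyMinimal] [NeZero (W.conductorNorm ℤ)],
    Squarefree (W.conductorNorm ℤ) → 0 < W.Δ → NoRationalTwoTorsion W →
    ∀ (Dt : ModularParametrizationData W (W.conductorNorm ℤ)), Odd Dt.c →
      ¬ (2 ^ (omegaConductor W + 1) ∣ Dt.modularDegree) →
      SameQuadraticResolventAtTwo W ∧
        ∀ (F : Type) [Field F] [NumberField F], IsCubicTwoDivisionField W F → RayClassOddAtTwo F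

end CompositeFloor

end

end Summit.BirchSwinnertonDyer.Rank1Residual.F1Sign2.ANg21
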